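import Summits.BirchSwinnertonDyer.Rank1Residual.X11b.AnticyclotomicLocalKernelTrivial
import HarnessLib

/-!
# X11b, route R1 — Cas18 Thm. 2.3 from TWO Poitou–Tate atoms where the local kernels vanish:
# `E(K_w)[p] = 0` at every `w ∈ Σ(N⁺)` ⟹ ((P6) ∧ (L10) ⟹ `ControlOnTreeAt`), no surjectivity input

HONEST FRAMING (cell `b2b-bsdres`, run/shared/lean/b2b/bsd-rank1-residual/, verbatim in every
file): the goal of the cell is to DELETE the COMBINATION-SHAPED residual classes of the
Birch–Swinnerton-Dyer formula for ALL analytic-rank `≤ 1` elliptic curves over `ℚ` — "full BSD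
formula for every rank `≤ 1` curve in class `C`" assembled STRICTLY from published theorems — so
that the rank-`≤ 1` remainder becomes exactly the CONSTRUCTION-SHAPED classes, which are TYPED
(missing-input `Prop`s), NOT attempted. This is not "finishing BSD". Sub-cell
`b2b-bsdres-multr1-p1` (X11b, route R1 = Castella 2018 Thm. A re-proved along the author's
erratum); a RESEARCH ROUTE; no claim beyond the stated class; X11b stays CONSTRUCTION-SHAPED;
nothing here changes a label; no named fact is minted (theorems only; no `sorry`).

## What this file proves

In `AnticyclotomicControlAtoms` Cas18 Thm. 2.3 at a datum (`ControlOnTreeAt`) was derived from four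
typed atoms (P6) `BaseSelmerCountAt`, (P9) `LocSurjAt`, (L10) `CoinvariantsTrivialAt`, (P11)
`LocalKernelOrderAt`. The surjectivity (P9) of the localisation `loc_{Σ(N⁺)}` (JSW17 Prop. 3.3.2,
Poitou–Tate) is used ONLY to hit the subgroup `∏_{w∈Σ(N⁺)} ker r_w`; where every local kernel
vanishes that subgroup is `0` and (P9) is idle. With `AnticyclotomicLocalKernelTrivial`
(`E(K_w)[p] = 0 ⟹ ker r_w = 0`):

* `AcSelmer.localKerPi_eq_bot_of_forall` — `ker r_w = 0` for all `w ∈ Σ` ⟹ `∏_{w∈Σ} ker r_w = ⊥`;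
* `AcSelmer.natCard_endInvariants_empty_eq_of_localKer_eq_bot` — then, `s^Σ` bijective:
  `#Sel_𝔭(K_∞, E[p^∞])^γ = #Sel_𝔭(K, E[p^∞])` (the `Σ → ∅` passage collapses: `Sel_𝔭(K, E[p^∞]) ≅
  Sel_𝔭(K_∞, E[p^∞])^Γ`, Greenberg's exact control with no local defect);
* **`controlOnTreeAt_of_two_atoms_of_noPTorsion`** — on the A′-hypotheses, `K` imaginary quadratic
  with `p` split, `κ` anticyclotomic with topological generator `γ`, `𝔭 ∣ p` of degree one, any `ι`,
  `P`: if `E(K_w)[p] = 0` and `p ∤ c_w(E/K)` at EVERY `w ∈ Σ(N⁺)`, then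
  (P6) ∧ (L10) ⟹ `ControlOnTreeAt p κ 𝔭 γ ι P` — Cas18 Thm. 2.3 from JSW17 Prop. 3.2.1/(7.1.5) (the
  count of `#Sel_𝔭(K, E[p^∞])`) and Lemma 3.3.3 (`Sel_Γ = 0`) ALONE, with `ord_p f_ac(0) = a` and
  `ord_p ∏_{w∣N⁺} c_w = Σ_{w∣p} ord_p c_w`;
* `ErratumHypotheses.natCard_endInvariants_empty_eq_natCard_base_of_noPTorsion` — the collapsed
  passage on route R1 (no atom at all): `#Sel_𝔭(K_∞, E[p^∞])^γ = #Sel_𝔭(K, E[p^∞])`.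

The locally-trivial condition at a split `ℓ` below `w` reads `E(ℚ_ℓ)[p] = 0` (⟸ `p ∤ c_ℓ(E)·#Ẽ_ns(𝔽_ℓ)`,
`#Ẽ_ns(𝔽_ℓ) = ℓ − a_ℓ`) — a decidable condition on `(E, p)`; its census over the `ChainLocus` pairs
with `N < 5·10⁵` is recorded in the unit's REPORT (data, not a claim).

References: [JetchevSkinnerWan2017] §3.3.4, Prop. 3.3.4 (arXiv:1512.06894 pp. 12–14); [GreenbergLNM1716]
§3 pp. 74–75, 85–90; [Castella2018] Thm. 2.3 (arXiv:1704.06608 p. 5).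
-/

noncomputable section

open scoped Classical

open WeierstrassCurve NumberField IsDedekindDomain Field
open Literature.NumberTheory.EllipticCurves Literature.NumberTheory.EllipticCurves.GreenbergSelmer
open Literature.NumberTheory.EllipticCurves.Rank1Residual
open Literature.NumberTheory.EllipticCurves.Rank1Residual.Typed
open Literature.NumberTheory.GaloisRepresentations
open Summit.BirchSwinnertonDyer.Rank1Residual.X11b.AcSelmer

namespace Summit.BirchSwinnertonDyer.Rank1Residual.X11b

/-! ## `∏ ker r_w = ⊥` and the collapsed passage -/

section Collapse

variable {K : Type} [Field K] [NumberField K] {E : WeierstrassCurve K} {p : ℕ} [Fact p.Prime]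
  {κ : ZpExtension K p} {𝔭 : HeightOneSpectrum (𝓞 K)} {S : Set (HeightOneSpectrum (𝓞 K))}
  {hS : S.Finite}

/-- `ker r_w = 0` for every `w ∈ Σ` ⟹ `∏_{w∈Σ} ker r_w = ⊥`. [folklore] -/
theorem AcSelmer.localKerPi_eq_bot_of_forall
    (h : ∀ v ∈ S, localKer κ.kerSubgroup (E.geomPrimaryTorsion p) v = ⊥) :
    localKerPi E p κ hS = ⊥ := by
  rw [eq_bot_iff]
  intro x hx
  rw [AddSubgroup.mem_bot]
  funext v
  have hv := (mem_localKerPi_iff x).mp hx v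
  rw [h v (hS.mem_toFinset.mp v.2), AddSubgroup.mem_bot] at hv
  rw [hv, Pi.zero_apply]

/-- **Exact control with no local defect**: `Σ` finite away from `p`, `s^Σ` bijective and `ker r_w = 0`
for every `w ∈ Σ` ⟹ `#Sel_𝔭(K_∞, E[p^∞])^γ = #Sel_𝔭(K, E[p^∞])` (the `Σ → ∅` passage with
`∏ ker r_w = 0`). [cite: GreenbergLNM1716, §3 Thm. 1.2 and p. 90] [cite: JetchevSkinnerWan2017, §3.3.4 (arXiv:1512.06894 pp. 13–14)] -/
theorem AcSelmer.natCard_endInvariants_empty_eq_of_localKer_eq_bot (hS : S.Finite)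
    (hSp : ∀ v ∈ S, ((p : ℕ) : 𝓞 K) ∉ v.asIdeal) (γ : absoluteGaloisGroup K)
    (hbij : Function.Bijective (controlMap E p κ 𝔭 S γ))
    (h : ∀ v ∈ S, localKer κ.kerSubgroup (E.geomPrimaryTorsion p) v = ⊥) :
    Nat.card (IwasawaDual.endInvariants (conjSelmerAc E p κ 𝔭 ∅ γ - 1)) =
      Nat.card (selmerAcBase E p 𝔭 ∅) := by
  rw [natCard_endInvariants_empty_eq (hS := hS) hSp γ hbij, localKerPi_eq_bot_of_forall h, inf_bot_eq,
    AddSubgroup.card_bot, mul_one]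

end Collapse

/-! ## Route R1: Cas18 Thm. 2.3 from (P6) and (L10) where `E(K_w)[p] = 0` on `Σ(N⁺)` -/

section RouteR1

variable {W : WeierstrassCurve ℚ} [W.IsElliptic] [W.IsGloballyMinimal] {K : Type} [Field K]
  [NumberField K] {p : ℕ} [Fact p.Prime]

/-- **The collapsed passage on the A′-hypotheses**: for `K` imaginary quadratic, `κ` anticyclotomic
with topological generator `γ`, `𝔭 ∣ p` of degree one, if `E(K_w)[p] = 0` at every `w ∈ Σ(N⁺)` then
`#Sel_𝔭(K_∞, E[p^∞])^γ = #Sel_𝔭(K, E[p^∞])` — NO typed input. [cite: GreenbergLNM1716, §3 Thm. 1.2 and pp. 74–75] [cite: JetchevSkinnerWan2017, §3.3.4 (arXiv:1512.06894 pp. 13–14)] -/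
theorem ErratumHypotheses.natCard_endInvariants_empty_eq_natCard_base_of_noPTorsion
    (hE : ErratumHypotheses W p) (hK : IsImaginaryQuadratic K) {κ : ZpExtension K p}
    (hκ : κ.IsAnticyclotomic) {γ : absoluteGaloisGroup K} (hγ : κ.IsTopGenerator γ)
    (𝔭 : HeightOneSpectrum (𝓞 K)) (h𝔭 : ((p : ℕ) : 𝓞 K) ∈ 𝔭.asIdeal)
    (he : 𝔭.asIdeal.ramificationIdx (𝓞 ℚ) = 1) (hf : 𝔭.asIdeal.inertiaDeg (𝓞 ℚ) = 1)
    (hloc : ∀ v ∈ nPlusPlaces W K p,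
      ∀ R : ((W.baseChange K).baseChange (v.adicCompletion K)).toAffine.Point, p • R = 0 → R = 0) :
    Nat.card (IwasawaDual.endInvariants (conjSelmerAc (W.baseChange K) p κ 𝔭 ∅ γ - 1)) =
      Nat.card (selmerAcBase (W.baseChange K) p 𝔭 ∅) :=
  haveI : (W.baseChange K).IsElliptic := by rw [baseChange]; infer_instance
  AcSelmer.natCard_endInvariants_empty_eq_of_localKer_eq_bot (nPlusPlaces_finite hK.1)
    (fun v hv ↦ ((mem_nPlusPlaces_iff v).mp hv).1) γ (hE.controlMap_bijective_nPlus hK hκ hγ 𝔭 h𝔭 he hf)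
    fun v hv ↦ AcSelmer.localKer_eq_bot_of_noPTorsion (W.baseChange K) p κ v (hloc v hv)

/-- **Cas18 Thm. 2.3 from (P6) ∧ (L10) alone where the local kernels vanish.** On the A′-hypotheses,
for `K` imaginary quadratic with `p` split, an anticyclotomic `κ` with topological generator `γ`, a
degree-one `𝔭 ∣ p`, any `ι`, `P`: if at EVERY `w ∈ Σ(N⁺)` `E(K_w)[p] = 0` and `p ∤ c_w(E/K)`, then
(P6) `BaseSelmerCountAt` (JSW17 Prop. 3.2.1/(7.1.5)) ∧ (L10) `CoinvariantsTrivialAt` (JSW17 Lemma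
3.3.3) ⟹ `ControlOnTreeAt p κ 𝔭 γ ι P`: `ord_p f_ac(0) = log_p #Sel_𝔭(K, E[p^∞]) = a` and
`ord_p ∏_{w∣N⁺} c_w = Σ_{w∣p} ord_p c_w`. The surjectivity atom (P9) and the local atom (P11) are not
needed. [cite: Castella2018, Thm. 2.3 (arXiv:1704.06608 p. 5)] [cite: JetchevSkinnerWan2017, Thm. 3.3.1, Prop. 3.2.1, Lemma 3.3.3 (arXiv:1512.06894 pp. 10–12)] -/
theorem controlOnTreeAt_of_two_atoms_of_noPTorsion (hE : ErratumHypotheses W p)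
    (hK : IsImaginaryQuadratic K) (hsplit : SplitsIn K p) {κ : ZpExtension K p}
    (hκ : κ.IsAnticyclotomic) (γ : absoluteGaloisGroup K) [hγ : Fact (κ.IsTopGenerator γ)]
    (𝔭 : HeightOneSpectrum (𝓞 K)) (h𝔭 : ((p : ℕ) : 𝓞 K) ∈ 𝔭.asIdeal)
    (he : 𝔭.asIdeal.ramificationIdx (𝓞 ℚ) = 1) (hf : 𝔭.asIdeal.inertiaDeg (𝓞 ℚ) = 1)
    (ι : K →+* ℚ_[p]) (P : (W.baseChange K).toAffine.Point)
    (h6 : BaseSelmerCountAt p 𝔭 ι P) (h10 : CoinvariantsTrivialAt (W.baseChange K) p κ 𝔭 γ)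
    (hloc : ∀ v ∈ nPlusPlaces W K p,
      (∀ R : ((W.baseChange K).baseChange (v.adicCompletion K)).toAffine.Point, p • R = 0 → R = 0) ∧
        ¬ p ∣ ((W.baseChange K).baseChange (v.adicCompletion K)).localTamagawaNumber
          (v.adicCompletionIntegers K)) :
    ControlOnTreeAt p κ 𝔭 γ ι P := by
  have hp : p.Prime := Fact.out
  rw [controlOnTreeAt_iff_card p κ 𝔭 γ ι P]
  obtain ⟨a, ⟨_, hcardK⟩, ha⟩ := h6
  have hpN : p ∣ W.conductorNorm ℤ := dvd_conductorNorm_of_mult hE.2.1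
  have hcard := hE.natCard_endInvariants_empty_eq_natCard_base_of_noPTorsion hK hκ hγ.out 𝔭 h𝔭 he hf
    fun v hv ↦ (hloc v hv).1
  have hcoinv := natCard_endCoinvariants_eq_one_of_surjective _ h10
  -- the Tamagawa sum over `Σ(N⁺)` vanishes
  have hsum : (∑ v ∈ (nPlusPlaces_finite (W := W) (p := p) hK.1).toFinset, padicValNat p
      (((W.baseChange K).baseChange (v.adicCompletion K)).localTamagawaNumber
        (v.adicCompletionIntegers K))) = 0 := by
    refine Finset.sum_eq_zero fun v hv ↦ ?_
    exact padicValNat.eq_zero_of_not_dvd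
      (hloc v ((nPlusPlaces_finite (W := W) (p := p) hK.1).mem_toFinset.mp hv)).2
  refine ⟨a, ⟨?_, ?_⟩, ?_⟩
  · refine Nat.finite_of_card_ne_zero ?_
    rw [hcard, hcardK]
    exact pow_ne_zero _ hp.ne_zero
  · rw [hcard, hcardK, hcoinv, mul_one]
  · rw [ha, padicValNat_tamagawaProductSplit_eq_above_add_sum W p hK.1 hsplit hpN, hsum]
    push_cast
    ring

end RouteR1

end Summit.BirchSwinnertonDyer.Rank1Residual.X11b

end
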